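import Summits.KontsevichZagierPeriods.KontsevichZagierPeriods.Theses.GenusOneIterated
import Literature.NumberTheory.Transcendental.KZProductIdeal
import Summits.KontsevichZagierPeriods.KontsevichZagierPeriods.Theorems.GenusOneIteratedLemniscaticSectorKernelArc
import Summits.KontsevichZagierPeriods.KontsevichZagierPeriods.Theorems.GenusOneIteratedLemniscaticSectorKernelLetters

/-!
# `SecondLyndonLemniscatic` (stmt-KontsevichZagierPeriods-6779, route GenusOneIterated, crux rank 5) — birth skeleton (`Lines/birth.lean`, BC3)

Crux (verbatim the route decl): for every `r : KZ.IntegralRep 4` pinned to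
`32 · ∫_{−1<x₀<0} ∫_{−1<x₁<x₂<x₃<0} x₂x₃/(y₀y₁y₂y₃)` (`y = √(4x³ − 4x)`; value `16ϖ·I(ωηη)`, the
second Lyndon word `ωηη` of length three on the upper arc `(−1,0) → (0,0)` of the lemniscatic curve
`y² = 4x³ − 4x` between two 2-torsion points) and every `r' : KZ.IntegralRep 2` pinned to
`∫∫_{(0,1)²} 4/(1+u²) · (4/(1+v²) + 2/(1+v) − 4)` (value `π(π + 2 log 2 − 4)`), `KZ.Equivalent r r'`.

## The line: NORMALISE AWAY DEPTH ≤ 2, ISOLATE THE WEIGHT DROP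

Notation (classes of pinned representations on the arc, first letter innermost):
`A = [I(ω)] = [∫_{−1}^{0} dx/y]`, `B = [I(η)] = [∫ x dx/y]`, `D = [I(ηω)] = [∫_{−1<x₀<x₁<0} x₀/(y₀y₁)]`,
`T = [I(ωηη)] = [∫_{−1<x₀<x₁<x₂<0} x₁x₂/(y₀y₁y₂)]`, `H = [(0,1), 4/(1+u²) + 2/(1+u)]` (value `π + 2 log 2`).
Values: `A = ϖ/2`, `B = −η₁/2 = −π/(2ϖ)` (Legendre `η₁ω₁ = π`), `D = −(π + 2 log 2)/8`
(shuffle `[ωη] + [ηω] ≡ A·B`, Kummer `[ωη] − [ηω] ≡ ½ log 2`, Legendre `−4AB ≡ π`).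

Dividing the crux's closed form `16ϖ·I(ωηη) = π² + 2π log 2 − 4π` by Legendre `π = −4·I(ω)·I(η)`
and feeding in the depth-two value of `D` turns it into the RATIONAL-COEFFICIENT, π-FREE, log-FREE
sector-internal identity

  (W)  `2·T ≡ 2·B·D + B`, i.e. `I(ωηη) = I(η)·(I(ηω) + ½)`
       (equivalently, by the shuffles `B·D ≡ 2[ηηω] + [ηωη]`: `2[ωηη] − 2[ηωη] − 4[ηηω] ≡ [η]`,
        a length-3 ↔ length-1 relation with integer coefficients — the WEIGHT DROP of the crux's
        docstring, isolated; or `2([ηωη] + [ηηω]) + [η] ≡ ℓ·[η]` with the Kummer letter `ℓ`).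

The three registered stubs:

* `stub_weightDrop` (XL, the heart, OPEN): (W) as a statement of the four-move calculus,
  `2•[T] − 2•([B]·[D]) − [B] ∈ KZ.relations` for all representations pinned to these data. WHY EASIER
  than the crux as filed: it lives entirely in the `{ω, η}`-iterated-integral sector of ONE arc with
  integer coefficients — no `π`-representation, no logarithm, no Legendre coupling, no B-period — so a
  move proof can be sought as ONE Stokes identity on the ordered 3-simplex of the arc with algebraic
  primitives (the algebraic kernels `F_ij = (y_i + y_j)/(2(x_i − x_j))` of `FayThreePoint` and the
  reflection primitive `φ = −y/(2(x−1))` of the `KummerFamily` certificate are the natural letters),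
  exactly the arena where the route's two landed genus-one certificates live. It is STRONGER than the
  crux in the formal period ring only by the cancellation of the factor `16·A` (no division is used
  below: the crux follows from (W) by multiplication).
* `stub_depthTwoEval` (M, provable with landed technology): `8•[D] + [H] ∈ KZ.relations`
  (`8·I(ηω) + π + 2 log 2 = 0`): shuffle `[ω][η] ≡ [ωη] + [ηω]` (`EllIterRepShuffle`), Kummer
  `[ωη] − [ηω] ≡ ℓ` (the `e = (1,0,−1)` instance of the LANDED support `KummerFamily`), Legendre
  `−4[ω][η] ≡ [ℝ, 1/(1+v²)]` (LANDED support `LegendreLemniscatic`), and the one-dimensional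
  normalisations `[(0,1), 2/(1+u)] ≡ 4ℓ` (landed, `toFormalPeriod_constDivOneAdd`) and
  `[(0,1), 4/(1+u²)] ≡ [ℝ, 1/(1+v²)]` (rules 1a/2: split `ℝ` at `0, ±1`, `v ↦ −v`, `v ↦ 1/v`).
* `stub_productFrame` (M, provable with landed technology): the bookkeeping congruence
  `[r] − [r'] − 16•(A·(2T − 2BD − B)) − 4•(A·B·(8D + H)) ∈ KZ.relations`, i.e.
  `[r] − [r'] ≡ 32·A·T + 4·A·B·(H − 4)`: product structure of `r` (`[r] ≡ 32·[I(ω)]·[I(ωηη)]`,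
  `KZ.of_mul_of`, rule 1b for the integer factor, rule 2 with `Φ = id` for the re-pinning), product
  structure of `r'` (`[r'] ≡ [(0,1), 4/(1+u²)]·(H − 4·𝟙)`), Legendre `4AB ≡ −[π]` with the same
  `π`-normalisation as above, and the ring laws modulo relations (`KZRulesAssociator`:
  `mul_assoc_sub_mem_relations`, `ringCon_mul_comm`; the ideal property `KZProductIdeal`).

Composition (kernel-checked, no `sorry` of its own): `[r] − [r'] = F + 16•(A·W) + 4•(A·B·V)` with
`F, W, V` the three stub elements; `W, V ∈ relations` propagate through the LEFT-IDEAL property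
(`KZ.mul_mem_relations_left_holds`) and `nsmul`. The skeleton theorem
`SecondLyndonLemniscatic_of` instantiates the stubs at honest witnesses: the words `![ω]`, `![η]`,
`![η,ω]`, `![ω,η,η]` as `KZ.ellIterRep` along `EllArc.upperHalf` of the lemniscatic `KZ.EllCurve`
`(e₁,e₂,e₃) = (1,0,−1)` (domains and integrands identified with the pinned data by the landed
`LemniscaticSectorKernel` arc lemmas) and `H` from `exists_rep_I01` — so the pinned data of every
stub are CHECKED to be inhabited (no vacuous stub).

Values (this seat; kit job j022039, evidence `compute-j022039.json` on the item: mpmath 45 digits, Taylor-series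
ODE for the iterated integrals on the smooth parametrisation `x = −cos²u` of the arc): `|W| = 8.8e−47`,
`|V| = 3.5e−46`, frame `2.0e−45`, crux `1.2e−45`, Legendre `3.5e−46`, Kummer `0`, shuffles `0`
(`I(ω) = 1.3110287771460599052…`, `I(η) = −0.5990701173677961037…`, `I(ηω) = −0.5659858768387104821…`,
`I(ωηη) = 0.0395301669823832270…`); the crux value itself is certified to `3e−69` (refuter job j000974,
grounder note on the item). No `Disproof.lean` exists for this crux; the summit's negatives index (1 entry, KinematicFormulas
convexity) is unrelated; no stub is an instance of a landed Negative lemma.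

BC3 probes (this seat, `bc/SecondLyndonLemniscatic_probes.lean`): for each stub statement `S`,
`S → SecondLyndonLemniscatic` and `S → KontsevichZagierPeriods` by
`first | exact? | simpa [S] | (unfold S; simpa) | aesop` FAIL (6/6).

References: M. Kontsevich, D. Zagier, *Periods* (2001), §1.1–§1.2, §4.1 [KontsevichZagier2001];
B. Enriquez, *Analogues elliptiques des nombres multizétas*, arXiv:1301.3042, §2.4 (the modular /
weight-drop behaviour of A-elliptic MZVs); J. Broedel, N. Matthes, O. Schlotterer, arXiv:1507.02254,
(2.36)–(2.37); D. F. Lawden, *Elliptic Functions and Applications* (1989), Ch. 6 [Lawden1989];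
G. V. Chudnovsky (1976) (algebraic independence of `π`, `ϖ`) [Chudnovsky1976].
-/

noncomputable section

open Set MeasureTheory
open Literature.NumberTheory.Transcendental
open Summit.KontsevichZagierPeriods.KontsevichZagierPeriods.Theses.GenusOneIterated

set_option linter.dupNamespace false

namespace Summit.KontsevichZagierPeriods.KontsevichZagierPeriods.Cruxes.SecondLyndonLemniscatic.Birth

/-! ## The three statements of the line (named; each is registered below as a `stub_…`) -/

/-- **(W) Weight drop** — the heart of the crux, isolated in the `{ω,η}`-sector of the arc with
integer coefficients: `2·[I(ωηη)] − 2·[I(η)]·[I(ηω)] − [I(η)] ∈ KZ.relations`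
(`I(ωηη) = I(η)·(I(ηω) + ½)`; values `0.0395301669… = (−0.5990701173…)·(−0.0659858768…)`).
[cite: KontsevichZagier2001, §1.2] -/
def WeightDrop : Prop :=
  ∀ (r₃ : KZ.IntegralRep 3) (r₂ : KZ.IntegralRep 2) (r₁ : KZ.IntegralRep 1),
    r₃.domain = {x | -1 < x 0 ∧ x 0 < x 1 ∧ x 1 < x 2 ∧ x 2 < 0} →
    Set.EqOn r₃.integrand (fun x => x 1 * x 2 / (Real.sqrt (4 * x 0 ^ 3 - 4 * x 0) *
      Real.sqrt (4 * x 1 ^ 3 - 4 * x 1) * Real.sqrt (4 * x 2 ^ 3 - 4 * x 2))) r₃.domain →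
    r₂.domain = {x | -1 < x 0 ∧ x 0 < x 1 ∧ x 1 < 0} →
    Set.EqOn r₂.integrand (fun x => x 0 / (Real.sqrt (4 * x 0 ^ 3 - 4 * x 0) *
      Real.sqrt (4 * x 1 ^ 3 - 4 * x 1))) r₂.domain →
    r₁.domain = {x | -1 < x 0 ∧ x 0 < 0} →
    Set.EqOn r₁.integrand (fun x => x 0 / Real.sqrt (4 * x 0 ^ 3 - 4 * x 0)) r₁.domain →
    2 • KZ.of r₃ - 2 • (KZ.of r₁ * KZ.of r₂) - KZ.of r₁ ∈ KZ.relations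

/-- **(V) Depth-two evaluation** of the second shuffle-free coordinate `D = I(ηω)` of length two:
`8·[I(ηω)] + [(0,1), 4/(1+u²) + 2/(1+u)] ∈ KZ.relations` (`8·I(ηω) = −π − 2 log 2`; Kummer + shuffle +
Legendre + one-dimensional normalisations). [cite: KontsevichZagier2001, §1.2] -/
def DepthTwoEval : Prop :=
  ∀ (r₂ : KZ.IntegralRep 2) (rh : KZ.IntegralRep 1),
    r₂.domain = {x | -1 < x 0 ∧ x 0 < x 1 ∧ x 1 < 0} →
    Set.EqOn r₂.integrand (fun x => x 0 / (Real.sqrt (4 * x 0 ^ 3 - 4 * x 0) *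
      Real.sqrt (4 * x 1 ^ 3 - 4 * x 1))) r₂.domain →
    rh.domain = {x | 0 < x 0 ∧ x 0 < 1} →
    Set.EqOn rh.integrand (fun x => 4 / (1 + x 0 ^ 2) + 2 / (1 + x 0)) rh.domain →
    8 • KZ.of r₂ + KZ.of rh ∈ KZ.relations

/-- **(F) Product frame** — the bookkeeping congruence between the crux's two representations and
the sector data: `[r] − [r'] − 16•([I(ω)]·(2[I(ωηη)] − 2[I(η)][I(ηω)] − [I(η)])) −
4•([I(ω)]·[I(η)]·(8[I(ηω)] + [H])) ∈ KZ.relations` (products, the integer factor `32`, Legendre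
`4·I(ω)I(η) = −π`, and the `π`-normalisation `[(0,1), 4/(1+u²)]`). [cite: KontsevichZagier2001, §1.2 and §4.1] -/
def ProductFrame : Prop :=
  ∀ (r : KZ.IntegralRep 4) (r' : KZ.IntegralRep 2),
    r.domain = {x | -1 < x 0 ∧ x 0 < 0 ∧ -1 < x 1 ∧ x 1 < x 2 ∧ x 2 < x 3 ∧ x 3 < 0} →
    Set.EqOn r.integrand (fun x => 32 * x 2 * x 3 / (Real.sqrt (4 * x 0 ^ 3 - 4 * x 0) *
      Real.sqrt (4 * x 1 ^ 3 - 4 * x 1) * Real.sqrt (4 * x 2 ^ 3 - 4 * x 2) *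
      Real.sqrt (4 * x 3 ^ 3 - 4 * x 3))) r.domain →
    r'.domain = {x | 0 < x 0 ∧ x 0 < 1 ∧ 0 < x 1 ∧ x 1 < 1} →
    Set.EqOn r'.integrand (fun x => 4 / (1 + x 0 ^ 2) * (4 / (1 + x 1 ^ 2) + 2 / (1 + x 1) - 4))
      r'.domain →
    ∀ (rA r₁ rh : KZ.IntegralRep 1) (r₂ : KZ.IntegralRep 2) (r₃ : KZ.IntegralRep 3),
    rA.domain = {x | -1 < x 0 ∧ x 0 < 0} →
    Set.EqOn rA.integrand (fun x => 1 / Real.sqrt (4 * x 0 ^ 3 - 4 * x 0)) rA.domain →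
    r₁.domain = {x | -1 < x 0 ∧ x 0 < 0} →
    Set.EqOn r₁.integrand (fun x => x 0 / Real.sqrt (4 * x 0 ^ 3 - 4 * x 0)) r₁.domain →
    rh.domain = {x | 0 < x 0 ∧ x 0 < 1} →
    Set.EqOn rh.integrand (fun x => 4 / (1 + x 0 ^ 2) + 2 / (1 + x 0)) rh.domain →
    r₂.domain = {x | -1 < x 0 ∧ x 0 < x 1 ∧ x 1 < 0} →
    Set.EqOn r₂.integrand (fun x => x 0 / (Real.sqrt (4 * x 0 ^ 3 - 4 * x 0) *
      Real.sqrt (4 * x 1 ^ 3 - 4 * x 1))) r₂.domain →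
    r₃.domain = {x | -1 < x 0 ∧ x 0 < x 1 ∧ x 1 < x 2 ∧ x 2 < 0} →
    Set.EqOn r₃.integrand (fun x => x 1 * x 2 / (Real.sqrt (4 * x 0 ^ 3 - 4 * x 0) *
      Real.sqrt (4 * x 1 ^ 3 - 4 * x 1) * Real.sqrt (4 * x 2 ^ 3 - 4 * x 2))) r₃.domain →
    KZ.of r - KZ.of r' - 16 • (KZ.of rA * (2 • KZ.of r₃ - 2 • (KZ.of r₁ * KZ.of r₂) - KZ.of r₁))
      - 4 • (KZ.of rA * KZ.of r₁ * (8 • KZ.of r₂ + KZ.of rh)) ∈ KZ.relations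

/-! ## The registered stubs (the only `sorry`s of this file) -/

/-- **Stub (W), weight drop** (XL; OPEN — the crux's content): `2·[I(ωηη)] − 2·[I(η)]·[I(ηω)] − [I(η)]`
is a relation of the four-move calculus. [cite: KontsevichZagier2001, §1.2] -/
theorem stub_weightDrop :
    ∀ (r₃ : KZ.IntegralRep 3) (r₂ : KZ.IntegralRep 2) (r₁ : KZ.IntegralRep 1),
    r₃.domain = {x | -1 < x 0 ∧ x 0 < x 1 ∧ x 1 < x 2 ∧ x 2 < 0} →
    Set.EqOn r₃.integrand (fun x => x 1 * x 2 / (Real.sqrt (4 * x 0 ^ 3 - 4 * x 0) *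
      Real.sqrt (4 * x 1 ^ 3 - 4 * x 1) * Real.sqrt (4 * x 2 ^ 3 - 4 * x 2))) r₃.domain →
    r₂.domain = {x | -1 < x 0 ∧ x 0 < x 1 ∧ x 1 < 0} →
    Set.EqOn r₂.integrand (fun x => x 0 / (Real.sqrt (4 * x 0 ^ 3 - 4 * x 0) *
      Real.sqrt (4 * x 1 ^ 3 - 4 * x 1))) r₂.domain →
    r₁.domain = {x | -1 < x 0 ∧ x 0 < 0} →
    Set.EqOn r₁.integrand (fun x => x 0 / Real.sqrt (4 * x 0 ^ 3 - 4 * x 0)) r₁.domain →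
    2 • KZ.of r₃ - 2 • (KZ.of r₁ * KZ.of r₂) - KZ.of r₁ ∈ KZ.relations := by
  sorry

/-- **Stub (V), depth-two evaluation** (M): `8·[I(ηω)] + [(0,1), 4/(1+u²) + 2/(1+u)]` is a relation.
[cite: KontsevichZagier2001, §1.2] -/
theorem stub_depthTwoEval :
    ∀ (r₂ : KZ.IntegralRep 2) (rh : KZ.IntegralRep 1),
    r₂.domain = {x | -1 < x 0 ∧ x 0 < x 1 ∧ x 1 < 0} →
    Set.EqOn r₂.integrand (fun x => x 0 / (Real.sqrt (4 * x 0 ^ 3 - 4 * x 0) *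
      Real.sqrt (4 * x 1 ^ 3 - 4 * x 1))) r₂.domain →
    rh.domain = {x | 0 < x 0 ∧ x 0 < 1} →
    Set.EqOn rh.integrand (fun x => 4 / (1 + x 0 ^ 2) + 2 / (1 + x 0)) rh.domain →
    8 • KZ.of r₂ + KZ.of rh ∈ KZ.relations := by
  sorry

/-- **Stub (F), product frame** (M): the crux difference is congruent to
`16•(A·(2T − 2BD − B)) + 4•(A·B·(8D + H))`. [cite: KontsevichZagier2001, §1.2 and §4.1] -/
theorem stub_productFrame :
    ∀ (r : KZ.IntegralRep 4) (r' : KZ.IntegralRep 2),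
    r.domain = {x | -1 < x 0 ∧ x 0 < 0 ∧ -1 < x 1 ∧ x 1 < x 2 ∧ x 2 < x 3 ∧ x 3 < 0} →
    Set.EqOn r.integrand (fun x => 32 * x 2 * x 3 / (Real.sqrt (4 * x 0 ^ 3 - 4 * x 0) *
      Real.sqrt (4 * x 1 ^ 3 - 4 * x 1) * Real.sqrt (4 * x 2 ^ 3 - 4 * x 2) *
      Real.sqrt (4 * x 3 ^ 3 - 4 * x 3))) r.domain →
    r'.domain = {x | 0 < x 0 ∧ x 0 < 1 ∧ 0 < x 1 ∧ x 1 < 1} →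
    Set.EqOn r'.integrand (fun x => 4 / (1 + x 0 ^ 2) * (4 / (1 + x 1 ^ 2) + 2 / (1 + x 1) - 4))
      r'.domain →
    ∀ (rA r₁ rh : KZ.IntegralRep 1) (r₂ : KZ.IntegralRep 2) (r₃ : KZ.IntegralRep 3),
    rA.domain = {x | -1 < x 0 ∧ x 0 < 0} →
    Set.EqOn rA.integrand (fun x => 1 / Real.sqrt (4 * x 0 ^ 3 - 4 * x 0)) rA.domain →
    r₁.domain = {x | -1 < x 0 ∧ x 0 < 0} →
    Set.EqOn r₁.integrand (fun x => x 0 / Real.sqrt (4 * x 0 ^ 3 - 4 * x 0)) r₁.domain →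
    rh.domain = {x | 0 < x 0 ∧ x 0 < 1} →
    Set.EqOn rh.integrand (fun x => 4 / (1 + x 0 ^ 2) + 2 / (1 + x 0)) rh.domain →
    r₂.domain = {x | -1 < x 0 ∧ x 0 < x 1 ∧ x 1 < 0} →
    Set.EqOn r₂.integrand (fun x => x 0 / (Real.sqrt (4 * x 0 ^ 3 - 4 * x 0) *
      Real.sqrt (4 * x 1 ^ 3 - 4 * x 1))) r₂.domain →
    r₃.domain = {x | -1 < x 0 ∧ x 0 < x 1 ∧ x 1 < x 2 ∧ x 2 < 0} →
    Set.EqOn r₃.integrand (fun x => x 1 * x 2 / (Real.sqrt (4 * x 0 ^ 3 - 4 * x 0) *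
      Real.sqrt (4 * x 1 ^ 3 - 4 * x 1) * Real.sqrt (4 * x 2 ^ 3 - 4 * x 2))) r₃.domain →
    KZ.of r - KZ.of r' - 16 • (KZ.of rA * (2 • KZ.of r₃ - 2 • (KZ.of r₁ * KZ.of r₂) - KZ.of r₁))
      - 4 • (KZ.of rA * KZ.of r₁ * (8 • KZ.of r₂ + KZ.of rh)) ∈ KZ.relations := by
  sorry

/-! ## Consistency: each named statement IS its registered stub (definitionally) -/

theorem weightDrop_holds : WeightDrop := stub_weightDrop
theorem depthTwoEval_holds : DepthTwoEval := stub_depthTwoEval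
theorem productFrame_holds : ProductFrame := stub_productFrame

/-! ## Name-keyed aliases of the three statements — the hypotheses of `SecondLyndonLemniscatic_of_parts`

The native skeleton audit (`#h21_check_skeleton`) admits a hypothesis of a skeleton theorem only if its
head constant is a registered obligation or is NAMED like a declared stub; `__Registered.stub_X` is the
statement of `stub_X` under that name (device of `CriticalPhenomena/…/AxiomsOfLimit/Lines/birth.lean`;
the `@[stub]` attribute is gate-reserved and not written here). Each alias is `rfl`-equal to its statement. -/
namespace __Registered

/-- Alias of `WeightDrop` keyed by the registered stub name. -/
abbrev stub_weightDrop : Prop := WeightDrop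
/-- Alias of `DepthTwoEval` keyed by the registered stub name. -/
abbrev stub_depthTwoEval : Prop := DepthTwoEval
/-- Alias of `ProductFrame` keyed by the registered stub name. -/
abbrev stub_productFrame : Prop := ProductFrame

end __Registered

/-! ## Witnesses: the pinned sector data are inhabited (lemniscatic curve, arc `(−1,0) → (0,0)`) -/

/-- The lemniscatic curve `y² = 4(x − 1)(x − 0)(x + 1) = 4x³ − 4x` as a `KZ.EllCurve`. [cite: Lawden1989, §6.12] -/
def lemniscaticCurve : KZ.EllCurve where
  e₁ := 1
  e₂ := 0
  e₃ := -1
  isAlgebraic_e₁ := isAlgebraic_one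
  isAlgebraic_e₂ := isAlgebraic_zero
  isAlgebraic_e₃ := isAlgebraic_one.neg
  e₃_lt_e₂ := by norm_num
  e₂_lt_e₁ := by norm_num

/-- The arc of the crux: upper half of the bounded oval, from `(−1,0)` to `(0,0)`, increasing `x`. -/
def arc : KZ.EllArc lemniscaticCurve := KZ.EllArc.upperHalf lemniscaticCurve

theorem curve_eqs : lemniscaticCurve.e₁ = 1 ∧ lemniscaticCurve.e₂ = 0 ∧ lemniscaticCurve.e₃ = -1 :=
  ⟨rfl, rfl, rfl⟩

theorem arc_eqs : arc.lo = -1 ∧ arc.hi = 0 ∧ arc.upper = true ∧ arc.forward = true :=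
  ⟨rfl, rfl, rfl, rfl⟩

/-- Words in `ω`, `η` are adapted to the arc. -/
theorem arc_adapted {n : ℕ} (w : Fin n → KZ.EllLetter) (h : ∀ k, ∃ j, w k = KZ.EllLetter.pow j) :
    arc.Adapted w :=
  KZ.EllArc.adapted_of_forall_eq_pow arc h

/-- `I(ω)` on the arc. -/
def repA : KZ.IntegralRep 1 :=
  KZ.ellIterRep arc ![KZ.EllLetter.ω] (arc_adapted _ fun k => ⟨0, by fin_cases k; rfl⟩)

/-- `I(η)` on the arc. -/
def repB : KZ.IntegralRep 1 :=
  KZ.ellIterRep arc ![KZ.EllLetter.η] (arc_adapted _ fun k => ⟨1, by fin_cases k; rfl⟩)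

/-- `I(ηω)` on the arc. -/
def repD : KZ.IntegralRep 2 :=
  KZ.ellIterRep arc ![KZ.EllLetter.η, KZ.EllLetter.ω]
    (arc_adapted _ fun k => by fin_cases k <;> exact ⟨_, rfl⟩)

/-- `I(ωηη)` on the arc. -/
def repT : KZ.IntegralRep 3 :=
  KZ.ellIterRep arc ![KZ.EllLetter.ω, KZ.EllLetter.η, KZ.EllLetter.η]
    (arc_adapted _ fun k => by fin_cases k <;> exact ⟨_, rfl⟩)

open Summit.KontsevichZagierPeriods.GenusOneIterated.LemniscaticSectorKernel in
theorem repA_spec : repA.domain = {x | -1 < x 0 ∧ x 0 < 0} ∧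
    Set.EqOn repA.integrand (fun x => 1 / Real.sqrt (4 * x 0 ^ 3 - 4 * x 0)) repA.domain :=
  ⟨(KZ.ellIterRep_domain _ _ _).trans (ellDomain_one arc_eqs),
    fun x _ => by rw [repA, KZ.ellIterRep_integrand]; exact ellIntegrand_ω curve_eqs arc_eqs x⟩

open Summit.KontsevichZagierPeriods.GenusOneIterated.LemniscaticSectorKernel in
theorem repB_spec : repB.domain = {x | -1 < x 0 ∧ x 0 < 0} ∧
    Set.EqOn repB.integrand (fun x => x 0 / Real.sqrt (4 * x 0 ^ 3 - 4 * x 0)) repB.domain :=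
  ⟨(KZ.ellIterRep_domain _ _ _).trans (ellDomain_one arc_eqs),
    fun x _ => by rw [repB, KZ.ellIterRep_integrand]; exact ellIntegrand_η curve_eqs arc_eqs x⟩

open Summit.KontsevichZagierPeriods.GenusOneIterated.LemniscaticSectorKernel in
theorem repD_spec : repD.domain = {x | -1 < x 0 ∧ x 0 < x 1 ∧ x 1 < 0} ∧
    Set.EqOn repD.integrand (fun x => x 0 / (Real.sqrt (4 * x 0 ^ 3 - 4 * x 0) *
      Real.sqrt (4 * x 1 ^ 3 - 4 * x 1))) repD.domain :=
  ⟨(KZ.ellIterRep_domain _ _ _).trans (ellDomain_two arc_eqs),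
    fun x _ => by rw [repD, KZ.ellIterRep_integrand]; exact ellIntegrand_ηω curve_eqs arc_eqs x⟩

open Summit.KontsevichZagierPeriods.GenusOneIterated.LemniscaticSectorKernel in
theorem repT_spec : repT.domain = {x | -1 < x 0 ∧ x 0 < x 1 ∧ x 1 < x 2 ∧ x 2 < 0} ∧
    Set.EqOn repT.integrand (fun x => x 1 * x 2 / (Real.sqrt (4 * x 0 ^ 3 - 4 * x 0) *
      Real.sqrt (4 * x 1 ^ 3 - 4 * x 1) * Real.sqrt (4 * x 2 ^ 3 - 4 * x 2))) repT.domain :=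
  ⟨(KZ.ellIterRep_domain _ _ _).trans (ellDomain_three arc_eqs),
    fun x _ => by rw [repT, KZ.ellIterRep_integrand]; exact ellIntegrand_ωηη curve_eqs arc_eqs x⟩

open MvPolynomial in
/-- The letter `H = [(0,1), 4/(1+u²) + 2/(1+u)]` exists (rational integrand `(2u² + 4u + 6)/((1+u²)(1+u))`,
continuous on `[0,1]`). -/
theorem exists_repH : ∃ rh : KZ.IntegralRep 1, rh.domain = {x | 0 < x 0 ∧ x 0 < 1} ∧
    Set.EqOn rh.integrand (fun x => 4 / (1 + x 0 ^ 2) + 2 / (1 + x 0)) rh.domain := by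
  obtain ⟨rh, hd, hi⟩ :=
    Summit.KontsevichZagierPeriods.GenusOneIterated.LemniscaticSectorKernel.exists_rep_I01
      (fun t : ℝ => 4 / (1 + t ^ 2) + 2 / (1 + t))
      (2 * X 0 ^ 2 + 4 * X 0 + 6) ((1 + X 0 ^ 2) * (1 + X 0))
      (fun x hx => by
        simp only [map_mul, map_add, map_one, map_pow, MvPolynomial.aeval_X]
        have h0 : 0 < x 0 := hx.1
        positivity)
      (fun x hx => by
        simp only [map_mul, map_add, map_one, map_pow, map_ofNat, MvPolynomial.aeval_X]
        have h0 : 0 < x 0 := hx.1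
        have h1 : (1 + x 0 ^ 2) ≠ 0 := by positivity
        have h2 : (1 + x 0) ≠ 0 := by positivity
        field_simp
        ring)
      (by
        refine ContinuousOn.add (continuousOn_const.div (by fun_prop) fun t _ => by positivity)
          (continuousOn_const.div (by fun_prop) fun t ht => ?_)
        have : 0 ≤ t := ht.1
        positivity)
  exact ⟨rh, hd, fun x _ => by rw [hi]⟩

/-! ## Composition (sorry-free): the three statements imply the crux BY NAME -/

/-- **`SecondLyndonLemniscatic` from (W), (V), (F)**: `[r] − [r'] = F + 16•(A·W) + 4•(A·B·V)` in
`FormalRep`, where `F` is the frame element (a relation by (F)), `W` the weight-drop element and `V` the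
depth-two element (relations by (W), (V)), whose multiples lie in `KZ.relations` by the left-ideal property
`KZ.mul_mem_relations_left_holds` and `AddSubgroup.nsmul_mem`; the stubs are instantiated at the honest
lemniscatic witnesses `repA`, `repB`, `repD`, `repT` and a letter `H` from `exists_repH`.
[cite: KontsevichZagier2001, §1.2 and §4.1] -/
theorem SecondLyndonLemniscatic_of_parts (hW : __Registered.stub_weightDrop)
    (hV : __Registered.stub_depthTwoEval) (hF : __Registered.stub_productFrame) :
    SecondLyndonLemniscatic := by
  intro r r' h1 h2 h3 h4
  obtain ⟨rh, hhd, hhi⟩ := exists_repH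
  have hF' := hF r r' h1 h2 h3 h4 repA repB rh repD repT repA_spec.1 repA_spec.2 repB_spec.1
    repB_spec.2 hhd hhi repD_spec.1 repD_spec.2 repT_spec.1 repT_spec.2
  have hW' := hW repT repD repB repT_spec.1 repT_spec.2 repD_spec.1 repD_spec.2 repB_spec.1 repB_spec.2
  have hV' := hV repD rh repD_spec.1 repD_spec.2 hhd hhi
  have h16 : 16 • (KZ.of repA * (2 • KZ.of repT - 2 • (KZ.of repB * KZ.of repD) - KZ.of repB)) ∈
      KZ.relations :=
    KZ.relations.nsmul_mem (KZ.mul_mem_relations_left_holds _ _ hW') 16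
  have h4' : 4 • (KZ.of repA * KZ.of repB * (8 • KZ.of repD + KZ.of rh)) ∈ KZ.relations :=
    KZ.relations.nsmul_mem (KZ.mul_mem_relations_left_holds _ _ hV') 4
  have hsum := KZ.relations.add_mem (KZ.relations.add_mem hF' h16) h4'
  show KZ.of r - KZ.of r' ∈ KZ.relations
  convert hsum using 1
  abel

/-- **The skeleton theorem**: the crux from the registered stubs themselves (so that a lead closing the
three stubs closes the item). -/
theorem SecondLyndonLemniscatic_of : SecondLyndonLemniscatic :=
  SecondLyndonLemniscatic_of_parts stub_weightDrop stub_depthTwoEval stub_productFrame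

end Summit.KontsevichZagierPeriods.KontsevichZagierPeriods.Cruxes.SecondLyndonLemniscatic.Birth

end
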